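import Mathlib
import Literature.GroupTheory.CombinatorialGroupTheory.SignedHurwitzAction
import HarnessLib

/-!
# Travel lemmas for the signed Hurwitz action

Companion to `SignedHurwitzAction.lean` (signed Hurwitz moves `HurwitzStep Bf` on signed words
`List (V × Bool)`, orbits `HurwitzOrbit Bf`, `letters`, `classesOfSign`): the elementary
bookkeeping behind exchange / sorting arguments on monodromy factorisations (manipulations of
Hurwitz arc systems as in [GompfStipsiczGSM1999, §8.2]; here purely algebraic, for an ARBITRARY
bilinear pairing `Bf`, nothing geometric is asserted).
* §1 `classesOfSign` of `++`, `::`, `filter`; §2 lifting moves and orbits behind a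
  prefix; §3 invariants of moves and orbits: length, number of positive letters, the span of all
  classes, and — for an ALTERNATING pairing — non-vanishing of all classes (`b + c • a = 0` with
  `c = ± Bf a b` forces `Bf a b = 0`, so `c = 0`, so `b = 0`).
* §4 TRAVEL: a negative letter `w` travels through a block `B` to the right (`travel_right`) or
  to the left (`travel_left`), choosing at each positive letter the move that keeps that letter
  verbatim (`w` absorbs a multiple of a positive class) and at each negative letter the move that
  keeps `w` verbatim: afterwards `B'.filter (·.2) = B.filter (·.2)` and the class of `w` has
  moved inside `w + span (positive classes of B)`.  §5 `exists_adjacent`: a negative letter can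
  be brought, in this manner, immediately to the left of any given positive letter `y`.
* §6 `exists_redundant` (pigeonhole on `finrank`, over a division ring): a word with more
  positive letters than the rank of the span of (the images under a map `φ` of) its positive
  classes splits as `X ++ y :: Z`, `y` positive with class in the span of the positive classes
  of `X ++ Z`.
-/

noncomputable section

namespace Literature.GroupTheory.CombinatorialGroupTheory.SignedHurwitz

/-! ## §1 Set bookkeeping -/

section Sets

variable {V : Type*}

/-- Classes of sign `s` of a concatenation. [folklore] -/
theorem classesOfSign_append (l l' : List (V × Bool)) (s : Bool) :
    classesOfSign (l ++ l') s = classesOfSign l s ∪ classesOfSign l' s := by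
  ext v
  simp [classesOfSign, List.mem_append]

/-- Classes of sign `s` of `x :: l` when `x` has sign `s`. [folklore] -/
theorem classesOfSign_cons_of_eq {x : V × Bool} {s : Bool} (h : x.2 = s) (l : List (V × Bool)) :
    classesOfSign (x :: l) s = insert x.1 (classesOfSign l s) := by
  obtain ⟨a, b⟩ := x
  subst h
  ext v
  simp [classesOfSign, Prod.ext_iff]

/-- Classes of sign `s` of `x :: l` when `x` has the other sign. [folklore] -/
theorem classesOfSign_cons_of_ne {x : V × Bool} {s : Bool} (h : x.2 ≠ s) (l : List (V × Bool)) :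
    classesOfSign (x :: l) s = classesOfSign l s := by
  obtain ⟨a, b⟩ := x
  ext v
  simp only [classesOfSign, List.mem_cons, Prod.mk.injEq, Set.mem_setOf_eq, or_iff_right_iff_imp,
    and_imp]
  rintro - rfl
  exact absurd rfl h

/-- The positive classes are read off the sublist of positive letters. [folklore] -/
theorem classesOfSign_filter_true (l : List (V × Bool)) :
    classesOfSign (l.filter (·.2)) true = classesOfSign l true := by
  ext v
  simp [classesOfSign, List.mem_filter]

/-- The class of a letter of `l` is a letter class of `l`. [folklore] -/
theorem fst_mem_letters {x : V × Bool} {l : List (V × Bool)} (h : x ∈ l) : x.1 ∈ letters l :=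
  ⟨x.2, h⟩

/-- The class of a letter of sign `s` of `l` is a class of sign `s` of `l`. [folklore] -/
theorem mem_classesOfSign {x : V × Bool} {l : List (V × Bool)} {s : Bool} (h : x ∈ l)
    (hs : x.2 = s) : x.1 ∈ classesOfSign l s := by
  subst hs
  exact h

end Sets

/-! ## §2 Lifting moves into longer words -/

section Lift

variable {R : Type*} [CommRing R] {V : Type*} [AddCommGroup V] [Module R V]
  {Bf : V →ₗ[R] V →ₗ[R] R}

/-- A Hurwitz move after a fixed prefix. [folklore] -/
theorem HurwitzStep.append_left {l l' : List (V × Bool)} (h : HurwitzStep Bf l l')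
    (P : List (V × Bool)) : HurwitzStep Bf (P ++ l) (P ++ l') := by
  obtain ⟨pre, suf, a, b, rfl, h⟩ := h
  refine ⟨P ++ pre, suf, a, b, by simp, ?_⟩
  rcases h with rfl | rfl
  · exact Or.inl (by simp)
  · exact Or.inr (by simp)

/-- A Hurwitz orbit after a fixed prefix. [folklore] -/
theorem HurwitzOrbit.append_left {l l' : List (V × Bool)} (h : HurwitzOrbit Bf l l')
    (P : List (V × Bool)) : HurwitzOrbit Bf (P ++ l) (P ++ l') := by
  induction h with
  | refl => exact HurwitzOrbit.refl Bf _
  | tail _ hst ih => exact ih.trans (hst.append_left P).orbit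

/-- A Hurwitz orbit after a fixed first letter. [folklore] -/
theorem HurwitzOrbit.cons {l l' : List (V × Bool)} (h : HurwitzOrbit Bf l l') (q : V × Bool) :
    HurwitzOrbit Bf (q :: l) (q :: l') :=
  h.append_left [q]

end Lift

/-! ## §3 Invariants of moves and orbits -/

section Invariants

variable {R : Type*} [CommRing R] {V : Type*} [AddCommGroup V] [Module R V]
  {Bf : V →ₗ[R] V →ₗ[R] R}

/-- A Hurwitz move keeps the length. [folklore] -/
theorem HurwitzStep.length_eq {l l' : List (V × Bool)} (h : HurwitzStep Bf l l') :
    l'.length = l.length := by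
  obtain ⟨pre, suf, a, b, rfl, rfl | rfl⟩ := h <;> simp

/-- A Hurwitz move keeps the number of positive letters. [folklore] -/
theorem HurwitzStep.length_filter_eq {l l' : List (V × Bool)} (h : HurwitzStep Bf l l') :
    (l'.filter (·.2)).length = (l.filter (·.2)).length := by
  obtain ⟨pre, suf, ⟨a, sa⟩, ⟨b, sb⟩, rfl, rfl | rfl⟩ := h <;>
    cases sa <;> cases sb <;> simp [List.filter_append]

/-- A Hurwitz orbit keeps the length. [folklore] -/
theorem HurwitzOrbit.length_eq {l l' : List (V × Bool)} (h : HurwitzOrbit Bf l l') :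
    l'.length = l.length := by
  induction h with
  | refl => rfl
  | tail _ hst ih => exact hst.length_eq.trans ih

/-- A Hurwitz orbit keeps the number of positive letters. [folklore] -/
theorem HurwitzOrbit.length_filter_eq {l l' : List (V × Bool)} (h : HurwitzOrbit Bf l l') :
    (l'.filter (·.2)).length = (l.filter (·.2)).length := by
  induction h with
  | refl => rfl
  | tail _ hst ih => exact hst.length_filter_eq.trans ih

/-- Replacing two adjacent classes by classes in their span does not enlarge the span of all
classes. [folklore] -/
theorem span_letters_le_of_mem_span (pre suf : List (V × Bool)) (x y x' y' : V × Bool)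
    (hx : x'.1 ∈ Submodule.span R {x.1, y.1}) (hy : y'.1 ∈ Submodule.span R {x.1, y.1}) :
    Submodule.span R (letters (pre ++ x' :: y' :: suf)) ≤
      Submodule.span R (letters (pre ++ x :: y :: suf)) := by
  have hsub : ({x.1, y.1} : Set V) ⊆ letters (pre ++ x :: y :: suf) := by
    rintro v (rfl | rfl)
    · exact fst_mem_letters (by simp)
    · exact fst_mem_letters (by simp)
  rw [Submodule.span_le]
  rintro v ⟨s, hs⟩
  simp only [List.mem_append, List.mem_cons] at hs
  rcases hs with h | rfl | rfl | h
  · exact Submodule.subset_span (fst_mem_letters (x := (v, s)) (by simp [h]))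
  · exact Submodule.span_mono hsub hx
  · exact Submodule.span_mono hsub hy
  · exact Submodule.subset_span (fst_mem_letters (x := (v, s)) (by simp [h]))

/-- A Hurwitz move keeps the span of all classes (each move changes one class by a multiple of
its neighbour and is invertible). [folklore] -/
theorem HurwitzStep.span_letters_eq {l l' : List (V × Bool)} (h : HurwitzStep Bf l l') :
    Submodule.span R (letters l') = Submodule.span R (letters l) := by
  have m₁ : ∀ u v : V, u ∈ Submodule.span R ({u, v} : Set V) := fun u v =>
    Submodule.subset_span (by simp)
  have m₂ : ∀ u v : V, v ∈ Submodule.span R ({u, v} : Set V) := fun u v =>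
    Submodule.subset_span (by simp)
  obtain ⟨pre, suf, a, b, rfl, rfl | rfl⟩ := h
  · set c : R := sgn a.2 * Bf a.1 b.1
    exact le_antisymm (span_letters_le_of_mem_span pre suf a b _ a
        (add_mem (m₂ _ _) (Submodule.smul_mem _ c (m₁ _ _))) (m₁ _ _))
      (span_letters_le_of_mem_span pre suf _ a a b (m₂ _ _)
        (by simpa using (sub_mem (m₁ (b.1 + c • a.1) a.1)
          (Submodule.smul_mem _ c (m₂ (b.1 + c • a.1) a.1)))))
  · set c : R := sgn b.2 * Bf b.1 a.1
    exact le_antisymm (span_letters_le_of_mem_span pre suf a b b _ (m₂ _ _)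
        (sub_mem (m₁ _ _) (Submodule.smul_mem _ c (m₂ _ _))))
      (span_letters_le_of_mem_span pre suf b _ a b
        (by simpa using (add_mem (m₂ b.1 (a.1 - c • b.1))
          (Submodule.smul_mem _ c (m₁ b.1 (a.1 - c • b.1))))) (m₁ _ _))

/-- A Hurwitz orbit keeps the span of all classes. [folklore] -/
theorem HurwitzOrbit.span_letters_eq {l l' : List (V × Bool)} (h : HurwitzOrbit Bf l l') :
    Submodule.span R (letters l') = Submodule.span R (letters l) := by
  induction h with
  | refl => rfl
  | tail _ hst ih => exact hst.span_letters_eq.trans ih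

/-- For an ALTERNATING pairing a Hurwitz move kills no class: if all classes of `l` are non-zero,
so are all classes of `l'`. [folklore] -/
theorem HurwitzStep.ne_zero (hB : ∀ x, Bf x x = 0) {l l' : List (V × Bool)}
    (h : HurwitzStep Bf l l') (hl : ∀ x ∈ l, x.1 ≠ 0) : ∀ x ∈ l', x.1 ≠ 0 := by
  obtain ⟨pre, suf, a, b, rfl, rfl | rfl⟩ := h
  · simp only [List.forall_mem_append, List.forall_mem_cons] at hl ⊢
    obtain ⟨hpre, ha, hb, hsuf⟩ := hl
    refine ⟨hpre, fun h0 => hb ?_, ha, hsuf⟩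
    have h1 : Bf a.1 b.1 = 0 := by
      simpa [map_add, map_smul, hB] using congrArg (Bf a.1) h0
    simpa [h1] using h0
  · simp only [List.forall_mem_append, List.forall_mem_cons] at hl ⊢
    obtain ⟨hpre, ha, hb, hsuf⟩ := hl
    refine ⟨hpre, hb, fun h0 => ha ?_, hsuf⟩
    have h1 : Bf b.1 a.1 = 0 := by
      simpa [map_sub, map_smul, hB] using congrArg (Bf b.1) h0
    simpa [h1] using h0

/-- For an alternating pairing a Hurwitz orbit kills no class. [folklore] -/
theorem HurwitzOrbit.ne_zero (hB : ∀ x, Bf x x = 0) {l l' : List (V × Bool)}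
    (h : HurwitzOrbit Bf l l') (hl : ∀ x ∈ l, x.1 ≠ 0) : ∀ x ∈ l', x.1 ≠ 0 := by
  induction h with
  | refl => exact hl
  | tail _ hst ih => exact hst.ne_zero hB ih

end Invariants

/-! ## §4 Travel of a negative letter through a block -/

section Travel

variable {R : Type*} [CommRing R] {V : Type*} [AddCommGroup V] [Module R V]
  (Bf : V →ₗ[R] V →ₗ[R] R)

/-- TRAVEL TO THE RIGHT.  A negative letter `w` in front of a block `B` can be moved behind `B`
inside the Hurwitz orbit so that the positive letters of `B` are untouched (verbatim, in order),
`w` stays negative and its class changes by an element of the span of the positive classes of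
`B`. (Passing a positive `b`: the inverse move `w b ↦ b (w - ε_b Bf(b,w) b)`; passing a negative
`b`: the move `w b ↦ (b + ε_w Bf(w,b) w) w`.) [folklore] -/
theorem travel_right (w : V × Bool) (hw : w.2 = false) (B rest : List (V × Bool)) :
    ∃ (B' : List (V × Bool)) (w' : V × Bool),
      HurwitzOrbit Bf (w :: (B ++ rest)) (B' ++ w' :: rest) ∧ w'.2 = false ∧
      w'.1 - w.1 ∈ Submodule.span R (classesOfSign B true) ∧
      B'.filter (·.2) = B.filter (·.2) ∧ B'.length = B.length := by
  induction B generalizing w with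
  | nil => exact ⟨[], w, HurwitzOrbit.refl Bf _, hw, by simp, rfl, rfl⟩
  | cons b B ih =>
    have hmono : Submodule.span R (classesOfSign B true) ≤
        Submodule.span R (classesOfSign (b :: B) true) :=
      Submodule.span_mono fun v hv => List.mem_cons_of_mem b hv
    cases hb : b.2 with
    | true =>
      -- the positive `b` jumps to the front unchanged; `w` absorbs a multiple of `b.1`
      obtain ⟨B', w', hO, hw', hcl, hf, hlen⟩ := ih (w.1 - (sgn b.2 * Bf b.1 w.1) • b.1, w.2) hw
      have hstep : HurwitzStep Bf (w :: (b :: B ++ rest))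
          (b :: (w.1 - (sgn b.2 * Bf b.1 w.1) • b.1, w.2) :: (B ++ rest)) :=
        ⟨[], B ++ rest, w, b, rfl, Or.inr rfl⟩
      refine ⟨b :: B', w', hstep.orbit.trans (hO.cons b), hw', ?_, by simp [hb, hf], by simp [hlen]⟩
      have e : w'.1 - w.1 = (w'.1 - (w.1 - (sgn b.2 * Bf b.1 w.1) • b.1)) -
          (sgn b.2 * Bf b.1 w.1) • b.1 := by abel
      rw [e]
      exact sub_mem (hmono hcl)
        (Submodule.smul_mem _ _ (Submodule.subset_span (mem_classesOfSign List.mem_cons_self hb)))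
    | false =>
      -- `w` jumps over the negative `b` unchanged; `b` absorbs a multiple of `w.1`
      obtain ⟨B', w', hO, hw', hcl, hf, hlen⟩ := ih w hw
      have hstep : HurwitzStep Bf (w :: (b :: B ++ rest))
          ((b.1 + (sgn w.2 * Bf w.1 b.1) • w.1, b.2) :: w :: (B ++ rest)) :=
        ⟨[], B ++ rest, w, b, rfl, Or.inl rfl⟩
      exact ⟨(b.1 + (sgn w.2 * Bf w.1 b.1) • w.1, b.2) :: B', w', hstep.orbit.trans (hO.cons _),
        hw', hmono hcl, by simp [hb, hf], by simp [hlen]⟩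

/-- TRAVEL TO THE LEFT.  A negative letter `w` behind a block `B` can be moved in front of `B`
inside the Hurwitz orbit so that the positive letters of `B` are untouched (verbatim, in order),
`w` stays negative and its class changes by an element of the span of the positive classes of
`B`. (Passing a positive `b`: the move `b w ↦ (w + ε_b Bf(b,w) b) b`; passing a negative `b`: the
inverse move `b w ↦ w (b - ε_w Bf(w,b) w)`.) [folklore] -/
theorem travel_left (w : V × Bool) (hw : w.2 = false) (B : List (V × Bool)) :
    ∀ pre rest : List (V × Bool), ∃ (B' : List (V × Bool)) (w' : V × Bool),
      HurwitzOrbit Bf (pre ++ (B ++ w :: rest)) (pre ++ w' :: (B' ++ rest)) ∧ w'.2 = false ∧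
      w'.1 - w.1 ∈ Submodule.span R (classesOfSign B true) ∧
      B'.filter (·.2) = B.filter (·.2) ∧ B'.length = B.length := by
  induction B with
  | nil => intro pre rest; exact ⟨[], w, HurwitzOrbit.refl Bf _, hw, by simp, rfl, rfl⟩
  | cons b B ih =>
    intro pre rest
    have hmono : Submodule.span R (classesOfSign B true) ≤
        Submodule.span R (classesOfSign (b :: B) true) :=
      Submodule.span_mono fun v hv => List.mem_cons_of_mem b hv
    obtain ⟨B', w', hO, hw', hcl, hf, hlen⟩ := ih (pre ++ [b]) rest
    simp only [List.append_assoc, List.singleton_append] at hO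
    -- now `hO : HurwitzOrbit Bf (pre ++ b :: (B ++ w :: rest)) (pre ++ b :: w' :: (B' ++ rest))`
    cases hb : b.2 with
    | true =>
      -- `w'` jumps over the positive `b` absorbing a multiple of `b.1`; `b` unchanged
      have hstep : HurwitzStep Bf (pre ++ b :: w' :: (B' ++ rest))
          (pre ++ (w'.1 + (sgn b.2 * Bf b.1 w'.1) • b.1, w'.2) :: b :: (B' ++ rest)) :=
        ⟨pre, B' ++ rest, b, w', rfl, Or.inl rfl⟩
      refine ⟨b :: B', (w'.1 + (sgn b.2 * Bf b.1 w'.1) • b.1, w'.2), hO.trans hstep.orbit, hw',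
        ?_, by simp [hb, hf], by simp [hlen]⟩
      have e : w'.1 + (sgn b.2 * Bf b.1 w'.1) • b.1 - w.1 =
          (w'.1 - w.1) + (sgn b.2 * Bf b.1 w'.1) • b.1 := by abel
      rw [e]
      exact add_mem (hmono hcl)
        (Submodule.smul_mem _ _ (Submodule.subset_span (mem_classesOfSign List.mem_cons_self hb)))
    | false =>
      -- `w'` jumps over the negative `b` unchanged; `b` absorbs a multiple of `w'.1`
      have hstep : HurwitzStep Bf (pre ++ b :: w' :: (B' ++ rest))
          (pre ++ w' :: (b.1 - (sgn w'.2 * Bf w'.1 b.1) • w'.1, b.2) :: (B' ++ rest)) :=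
        ⟨pre, B' ++ rest, b, w', rfl, Or.inr rfl⟩
      exact ⟨(b.1 - (sgn w'.2 * Bf w'.1 b.1) • w'.1, b.2) :: B', w', hO.trans hstep.orbit, hw',
        hmono hcl, by simp [hb, hf], by simp [hlen]⟩

/-! ## §5 Bringing a negative letter next to a positive one -/

/-- Given a positive letter `y` of a word `X ++ y :: Z` and a negative letter `w` off `y`, the
Hurwitz orbit contains a word `A ++ w₁ :: y :: C` in which `y` is verbatim, its left neighbour
`w₁` is negative with `w₁ ≡ w` modulo the span of the positive classes, and the positive letters
off `y` are unchanged and in order. (Travel `w` towards `y`; if `w` was on the right, finish with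
the move `y w' ↦ (w' + Bf(y,w') y) y`.) [folklore] -/
theorem exists_adjacent (X Z : List (V × Bool)) (y w : V × Bool) (hy : y.2 = true)
    (hw : w.2 = false) (hmem : w ∈ X ++ Z) :
    ∃ (A C : List (V × Bool)) (w₁ : V × Bool),
      HurwitzOrbit Bf (X ++ y :: Z) (A ++ w₁ :: y :: C) ∧ w₁.2 = false ∧
      w₁.1 - w.1 ∈ Submodule.span R (classesOfSign (X ++ y :: Z) true) ∧
      (A ++ C).filter (·.2) = (X ++ Z).filter (·.2) := by
  rcases List.mem_append.mp hmem with h | h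
  · -- `w` on the left of `y`: travel right up to `y`
    obtain ⟨A₀, B, rfl⟩ := List.append_of_mem h
    obtain ⟨B', w', hO, hw', hcl, hf, -⟩ := travel_right Bf w hw B (y :: Z)
    refine ⟨A₀ ++ B', Z, w', ?_, hw', ?_, ?_⟩
    · have := hO.append_left A₀
      simpa using this
    · refine Submodule.span_mono (fun v hv => ?_) hcl
      show (v, true) ∈ A₀ ++ w :: B ++ y :: Z
      simp [show (v, true) ∈ B from hv]
    · simp [hw, hf]
  · -- `w` on the right of `y`: travel left up to `y`, then jump over `y`
    obtain ⟨B, C₀, rfl⟩ := List.append_of_mem h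
    obtain ⟨B', w', hO, hw', hcl, hf, -⟩ := travel_left Bf w hw B (X ++ [y]) C₀
    simp only [List.append_assoc, List.singleton_append] at hO
    have hstep : HurwitzStep Bf (X ++ y :: w' :: (B' ++ C₀))
        (X ++ (w'.1 + (sgn y.2 * Bf y.1 w'.1) • y.1, w'.2) :: y :: (B' ++ C₀)) :=
      ⟨X, B' ++ C₀, y, w', rfl, Or.inl rfl⟩
    refine ⟨X, B' ++ C₀, (w'.1 + (sgn y.2 * Bf y.1 w'.1) • y.1, w'.2), hO.trans hstep.orbit, hw',
      ?_, ?_⟩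
    · have e : w'.1 + (sgn y.2 * Bf y.1 w'.1) • y.1 - w.1 =
          (w'.1 - w.1) + (sgn y.2 * Bf y.1 w'.1) • y.1 := by abel
      rw [e]
      refine add_mem (Submodule.span_mono (fun v hv => ?_) hcl)
        (Submodule.smul_mem _ _ (Submodule.subset_span (mem_classesOfSign (by simp) hy)))
      show (v, true) ∈ X ++ y :: (B ++ w :: C₀)
      simp [show (v, true) ∈ B from hv]
    · simp [hw, hf]

end Travel

/-! ## §6 A redundant positive letter -/

section Redundant

variable {V : Type*} {K : Type*} [DivisionRing K] {W : Type*} [AddCommGroup W] [Module K W]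
  [FiniteDimensional K W]

/-- PIGEONHOLE.  If a signed word has more positive letters than the rank of the span of the
`φ`-images of its positive classes, then it decomposes as `X ++ y :: Z` with `y` positive and
`φ y.1` in the span of the `φ`-images of the positive classes of `X ++ Z`. [folklore] -/
theorem exists_redundant (φ : V → W) :
    ∀ l : List (V × Bool),
      Module.finrank K (Submodule.span K (φ '' classesOfSign l true)) < (l.filter (·.2)).length →
      ∃ (X Z : List (V × Bool)) (y : V × Bool), l = X ++ y :: Z ∧ y.2 = true ∧
        φ y.1 ∈ Submodule.span K (φ '' classesOfSign (X ++ Z) true)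
  | [], h => by simp at h
  | x :: l, h => by
    by_cases hx : x.2 = true
    · by_cases hmem : φ x.1 ∈ Submodule.span K (φ '' classesOfSign l true)
      · exact ⟨[], l, x, rfl, hx, by simpa using hmem⟩
      · -- `x` is not redundant: dropping it lowers the rank, recurse into the tail
        have hlt : Submodule.span K (φ '' classesOfSign l true) <
            Submodule.span K (φ '' classesOfSign (x :: l) true) := by
          rw [classesOfSign_cons_of_eq hx, Set.image_insert_eq]
          exact SetLike.lt_iff_le_and_exists.mpr ⟨Submodule.span_mono (Set.subset_insert _ _),
            φ x.1, Submodule.subset_span (Set.mem_insert _ _), hmem⟩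
        have hrk := Submodule.finrank_lt_finrank_of_lt hlt
        have hlen : ((x :: l).filter (·.2)).length = (l.filter (·.2)).length + 1 := by
          simp [hx]
        obtain ⟨X, Z, y, rfl, hy, hyU⟩ := exists_redundant φ l (by omega)
        refine ⟨x :: X, Z, y, rfl, hy, ?_⟩
        rw [List.cons_append, classesOfSign_cons_of_eq hx, Set.image_insert_eq]
        exact Submodule.span_mono (Set.subset_insert _ _) hyU
    · have hx' : x.2 = false := by simpa using hx
      have hne : x.2 ≠ true := by simp [hx']
      have hlen : ((x :: l).filter (·.2)).length = (l.filter (·.2)).length := by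
        simp [hx']
      rw [hlen, classesOfSign_cons_of_ne hne] at h
      obtain ⟨X, Z, y, rfl, hy, hyU⟩ := exists_redundant φ l h
      refine ⟨x :: X, Z, y, rfl, hy, ?_⟩
      rwa [List.cons_append, classesOfSign_cons_of_ne hne]

end Redundant

end Literature.GroupTheory.CombinatorialGroupTheory.SignedHurwitz

end
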